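import Summits.CriticalPhenomena.PercolationContinuityZ3.Theorems.PercNearOneGluingNoHeavyLowerTailSahiCombTriWHalfChainKernel
import Summits.CriticalPhenomena.PercolationContinuityZ3.Theorems.PercNearOneGluingNoHeavyLowerTailSahiCombTriWHalfChainMid
import Summits.CriticalPhenomena.PercolationContinuityZ3.Theorems.PercNearOneGluingNoHeavyLowerTailSahiCombTriWCommonBottom

/-!
# (HC) PROVED, self-contained form: the half-chain stratum of `TRI_W(2)` from the kernel lemma, without the typed Hall detour

Support file of the one-cut programme (crux `NoHeavyLowerTail`, stmt-CriticalPhenomena-4575; cell `prim-masterthm`, seat P5 gen 29;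
memo `FROM-prim-masterthm-p5-g29-HALFCHAIN-PROOF.md` §1–§2).  The kernel lemma `halfChain_kernel_eq_zero_of_upperSet` (`…TriWHalfChainKernel`, this seat) is turned
DIRECTLY into the unconditional half-chain stratum: the token identity (pair sum = supplies − demands, explicit counts), the counting corollary (the demand rows of the
HC-0 design matrix are linearly independent in `ℚ^{supplies}`) and the strata.  This file deliberately imports only `…TriWHalfChainKernel`, `…TriWHalfChainMid` and `…TriWCommonBottom`
(the typed statement `HalfChainHall` lives in `…TriWHalfChainHall`, whose module was unavailable on the build farm when this was written; the link
`halfChainHall_holds : HalfChainHall` is the companion `…TriWHalfChainHallProof`).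

* `FiveUpSet.halfChain_pair_eq_counts` — `triWOne(P;F₀,F₁;G₀,G₁) + triWOne(P;Fp,Fq;Gp,Gq) = supplies − demands` on `Gp ⊆ Gq` (explicit counts; pointwise `decide`);
* **`FiveUpSet.halfChain_pair_nonneg`** — `0 ≤ triWOne(P;F₀,F₁;G₀,G₁) + triWOne(P;Fp,Fq;Gp,Gq)` for up-sets `P`, `F₀ ⊆ Fp,Fq ⊆ F₁`, `G₀ ⊆ Gp ⊆ Gq ⊆ G₁`
  (`Fintype.linearIndependent_iff` + kernel lemma + `LinearIndependent.fintype_card_le_finrank`);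
* **`FiveUpSet.halfChainMidIneq_holds : HalfChainMidIneq`**, **`FiveUpSet.triW_nonneg_of_halfChain`** (`univ = {a,b}`, `G {a} ⊆ G {b}`, `F` ARBITRARY),
  **`FiveUpSet.triW_nonneg_two_of_one_comparable`** (a = 2: `TRI_W ≥ 0` unless BOTH families have incomparable middle fibres).
HONEST LABEL: complete proofs, std axioms; `TriWIneq` stays OPEN beyond this (doubly-incomparable middles at `a = 2`, and `a ≥ 3`). [this work]
-/

namespace Summit.CriticalPhenomena.PercolationContinuityZ3.Theorems

namespace FiveUpSet

open Finset LatticeFiveUpSet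

variable {γ : Type} [DecidableEq γ] [Fintype γ]

set_option synthInstance.maxHeartbeats 400000 in
set_option synthInstance.maxSize 4096 in
set_option maxHeartbeats 1600000 in
/-- **The token identity on the half-chain stratum, explicit counts** (`Gp ⊆ Gq`; same statement as `inner_pair_eq_halfChain` of `…TriWHalfChainHall` with the
supply/demand definitions unfolded). [this work] -/
theorem halfChain_pair_eq_counts (P F₀ Fp Fq F₁ G₀ Gp Gq G₁ : Finset (Finset γ))
    (hF0p : F₀ ⊆ Fp) (hF0q : F₀ ⊆ Fq) (hFp1 : Fp ⊆ F₁) (hFq1 : Fq ⊆ F₁) (hG0p : G₀ ⊆ Gp) (hG0q : G₀ ⊆ Gq) (hGp1 : Gp ⊆ G₁) (hGq1 : Gq ⊆ G₁)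
    (hGpq : Gp ⊆ Gq) :
    triWOne (complEquiv γ) P F₀ F₁ G₀ G₁ + triWOne (complEquiv γ) P Fp Fq Gp Gq
      = ((2 * (P ∩ F₁ ∩ G₁).card + 2 * (P ∩ F₀ ∩ G₀).card + 2 * (P ∩ Fp ∩ Gp).card + 2 * (P ∩ Fq ∩ Gq).card : ℕ) : ℤ) - (((P ∩ refl F₀ ∩ G₁).card + (P ∩ F₀ ∩ refl G₁).card + (P ∩ refl F₁ ∩ G₀).card + (P ∩ F₁ ∩ refl G₀).card + (P ∩ refl Fp ∩ Gq).card + (P ∩ Fp ∩ refl Gq).card + (P ∩ refl Fq ∩ Gp).card + (P ∩ Fq ∩ refl Gp).card + (P ∩ refl ((Fq \ Fp) ∩ (Gq \ Gp))).card + (P ∩ refl (((F₁ \ F₀) ∩ (G₁ \ G₀)) \ ((Fp \ Fq) ∩ (Gq \ Gp)))).card : ℕ) : ℤ) := by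
  rw [triWOne_expand, triWOne_expand]
  push_cast
  have h1 : 0 ≤ 1 * ((2 * (((P ∩ F₀ ∩ G₀).card : ℤ) + ((P ∩ F₁ ∩ G₁).card : ℤ)) - (((P ∩ refl F₀ ∩ G₁).card : ℤ) + ((P ∩ refl F₁ ∩ G₀).card : ℤ)) - (((P ∩ F₀ ∩ refl G₁).card : ℤ) + ((P ∩ F₁ ∩ refl G₀).card : ℤ)) - (((P ∩ refl F₀ ∩ refl G₀).card : ℤ) + ((P ∩ refl F₁ ∩ refl G₁).card : ℤ)) + (((P ∩ refl F₀ ∩ refl G₁).card : ℤ) + ((P ∩ refl F₁ ∩ refl G₀).card : ℤ))) + (2 * (((P ∩ Fp ∩ Gp).card : ℤ) + ((P ∩ Fq ∩ Gq).card : ℤ)) - (((P ∩ refl Fp ∩ Gq).card : ℤ) + ((P ∩ refl Fq ∩ Gp).card : ℤ)) - (((P ∩ Fp ∩ refl Gq).card : ℤ) + ((P ∩ Fq ∩ refl Gp).card : ℤ)) - (((P ∩ refl Fp ∩ refl Gp).card : ℤ) + ((P ∩ refl Fq ∩ refl Gq).card : ℤ)) + (((P ∩ refl Fp ∩ refl Gq).card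 : ℤ) + ((P ∩ refl Fq ∩ refl Gp).card : ℤ)))) - (1 * (2 * ((P ∩ F₁ ∩ G₁).card : ℤ) + 2 * ((P ∩ F₀ ∩ G₀).card : ℤ) + 2 * ((P ∩ Fp ∩ Gp).card : ℤ) + 2 * ((P ∩ Fq ∩ Gq).card : ℤ)) - 1 * (((P ∩ refl F₀ ∩ G₁).card : ℤ) + ((P ∩ F₀ ∩ refl G₁).card : ℤ) + ((P ∩ refl F₁ ∩ G₀).card : ℤ) + ((P ∩ F₁ ∩ refl G₀).card : ℤ) + ((P ∩ refl Fp ∩ Gq).card : ℤ) + ((P ∩ Fp ∩ refl Gq).card : ℤ) + ((P ∩ refl Fq ∩ Gp).card : ℤ) + ((P ∩ Fq ∩ refl Gp).card : ℤ) + ((P ∩ refl ((Fq \ Fp) ∩ (Gq \ Gp))).card : ℤ) + ((P ∩ refl (((F₁ \ F₀) ∩ (G₁ \ G₀)) \ ((Fp \ Fq) ∩ (Gq \ Gp)))).card : ℤ))) := by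
    simp only [card_eq_univ_sum]
    simp only [mem_inter, mem_refl, mem_sdiff]
    simp only [mul_add, mul_sub]
    simp only [Finset.mul_sum, ← Finset.sum_add_distrib, ← Finset.sum_sub_distrib]
    refine Finset.sum_nonneg (fun w _ => ?_)
    obtain ⟨s₁, a0, ap, aq, a1⟩ := diamond_pos hF0p hF0q hFp1 hFq1 w
    obtain ⟨s₂, b0, bp, bq, b1⟩ := diamond_pos hG0p hG0q hGp1 hGq1 w
    obtain ⟨s₃, c0, cp, cq, c1⟩ := diamond_pos hF0p hF0q hFp1 hFq1 wᶜ
    obtain ⟨s₄, d0, dp, dq, d1⟩ := diamond_pos hG0p hG0q hGp1 hGq1 wᶜ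
    have gpq : (s₂ = 2 ∨ s₂ = 4 ∨ s₂ = 5) → (s₂ = 3 ∨ s₂ = 4 ∨ s₂ = 5) := fun h => bq.mp (hGpq (bp.mpr h))
    have gpq' : (s₄ = 2 ∨ s₄ = 4 ∨ s₄ = 5) → (s₄ = 3 ∨ s₄ = 4 ∨ s₄ = 5) := fun h => dq.mp (hGpq (dp.mpr h))
    simp only [a0, ap, aq, a1, b0, bp, bq, b1, c0, cp, cq, c1, d0, dp, dq, d1]
    clear a0 ap aq a1 b0 bp bq b1 c0 cp cq c1 d0 dp dq d1
    by_cases hp : w ∈ P <;> simp only [hp] <;> (revert s₁ s₂ s₃ s₄; decide)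
  have h2 : 0 ≤ (1 * (2 * ((P ∩ F₁ ∩ G₁).card : ℤ) + 2 * ((P ∩ F₀ ∩ G₀).card : ℤ) + 2 * ((P ∩ Fp ∩ Gp).card : ℤ) + 2 * ((P ∩ Fq ∩ Gq).card : ℤ)) - 1 * (((P ∩ refl F₀ ∩ G₁).card : ℤ) + ((P ∩ F₀ ∩ refl G₁).card : ℤ) + ((P ∩ refl F₁ ∩ G₀).card : ℤ) + ((P ∩ F₁ ∩ refl G₀).card : ℤ) + ((P ∩ refl Fp ∩ Gq).card : ℤ) + ((P ∩ Fp ∩ refl Gq).card : ℤ) + ((P ∩ refl Fq ∩ Gp).card : ℤ) + ((P ∩ Fq ∩ refl Gp).card : ℤ) + ((P ∩ refl ((Fq \ Fp) ∩ (Gq \ Gp))).card : ℤ) + ((P ∩ refl (((F₁ \ F₀) ∩ (G₁ \ G₀)) \ ((Fp \ Fq) ∩ (Gq \ Gp)))).card : ℤ))) - 1 * ((2 * (((P ∩ F₀ ∩ G₀).card : ℤ) + ((P ∩ F₁ ∩ G₁).card : ℤ)) - (((P ∩ refl F₀ ∩ G₁).card : ℤ) + ((P ∩ refl F₁ ∩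 G₀).card : ℤ)) - (((P ∩ F₀ ∩ refl G₁).card : ℤ) + ((P ∩ F₁ ∩ refl G₀).card : ℤ)) - (((P ∩ refl F₀ ∩ refl G₀).card : ℤ) + ((P ∩ refl F₁ ∩ refl G₁).card : ℤ)) + (((P ∩ refl F₀ ∩ refl G₁).card : ℤ) + ((P ∩ refl F₁ ∩ refl G₀).card : ℤ))) + (2 * (((P ∩ Fp ∩ Gp).card : ℤ) + ((P ∩ Fq ∩ Gq).card : ℤ)) - (((P ∩ refl Fp ∩ Gq).card : ℤ) + ((P ∩ refl Fq ∩ Gp).card : ℤ)) - (((P ∩ Fp ∩ refl Gq).card : ℤ) + ((P ∩ Fq ∩ refl Gp).card : ℤ)) - (((P ∩ refl Fp ∩ refl Gp).card : ℤ) + ((P ∩ refl Fq ∩ refl Gq).card : ℤ)) + (((P ∩ refl Fp ∩ refl Gq).card : ℤ) + ((P ∩ refl Fq ∩ refl Gp).card : ℤ)))) := by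
    simp only [card_eq_univ_sum]
    simp only [mem_inter, mem_refl, mem_sdiff]
    simp only [mul_add, mul_sub]
    simp only [Finset.mul_sum, ← Finset.sum_add_distrib, ← Finset.sum_sub_distrib]
    refine Finset.sum_nonneg (fun w _ => ?_)
    obtain ⟨s₁, a0, ap, aq, a1⟩ := diamond_pos hF0p hF0q hFp1 hFq1 w
    obtain ⟨s₂, b0, bp, bq, b1⟩ := diamond_pos hG0p hG0q hGp1 hGq1 w
    obtain ⟨s₃, c0, cp, cq, c1⟩ := diamond_pos hF0p hF0q hFp1 hFq1 wᶜ
    obtain ⟨s₄, d0, dp, dq, d1⟩ := diamond_pos hG0p hG0q hGp1 hGq1 wᶜ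
    have gpq : (s₂ = 2 ∨ s₂ = 4 ∨ s₂ = 5) → (s₂ = 3 ∨ s₂ = 4 ∨ s₂ = 5) := fun h => bq.mp (hGpq (bp.mpr h))
    have gpq' : (s₄ = 2 ∨ s₄ = 4 ∨ s₄ = 5) → (s₄ = 3 ∨ s₄ = 4 ∨ s₄ = 5) := fun h => dq.mp (hGpq (dp.mpr h))
    simp only [a0, ap, aq, a1, b0, bp, bq, b1, c0, cp, cq, c1, d0, dp, dq, d1]
    clear a0 ap aq a1 b0 bp bq b1 c0 cp cq c1 d0 dp dq d1
    by_cases hp : w ∈ P <;> simp only [hp] <;> (revert s₁ s₂ s₃ s₄; decide)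
  linarith [h1, h2]

set_option maxHeartbeats 1600000 in
/-- **The pair sum is non-negative on the half-chain stratum**: for up-sets `P`, `F₀ ⊆ Fp, Fq ⊆ F₁`, `G₀ ⊆ Gp ⊆ Gq ⊆ G₁`,
`0 ≤ triWOne(P;F₀,F₁;G₀,G₁) + triWOne(P;Fp,Fq;Gp,Gq)`.  The ten demand classes' rows of the HC-0 design matrix are linearly independent in `ℚ^{supplies}`
by the kernel lemma, so `#demands ≤ #supplies`; then `halfChain_pair_eq_counts`. [this work] -/
theorem halfChain_pair_nonneg (P F₀ Fp Fq F₁ G₀ Gp Gq G₁ : Finset (Finset γ)) (hP : IsUpperSet (P : Set (Finset γ)))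
    (hF₀ : IsUpperSet (F₀ : Set (Finset γ))) (hFp : IsUpperSet (Fp : Set (Finset γ))) (hFq : IsUpperSet (Fq : Set (Finset γ)))
    (hF₁ : IsUpperSet (F₁ : Set (Finset γ))) (hG₀ : IsUpperSet (G₀ : Set (Finset γ))) (hGp : IsUpperSet (Gp : Set (Finset γ)))
    (hGq : IsUpperSet (Gq : Set (Finset γ))) (hG₁ : IsUpperSet (G₁ : Set (Finset γ)))
    (hF0p : F₀ ⊆ Fp) (hF0q : F₀ ⊆ Fq) (hFp1 : Fp ⊆ F₁) (hFq1 : Fq ⊆ F₁) (hG0p : G₀ ⊆ Gp) (hGpq : Gp ⊆ Gq) (hGq1 : Gq ⊆ G₁) :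
    0 ≤ triWOne (complEquiv γ) P F₀ F₁ G₀ G₁ + triWOne (complEquiv γ) P Fp Fq Gp Gq := by
  have hG0q : G₀ ⊆ Gq := hG0p.trans hGpq
  have hGp1 : Gp ⊆ G₁ := hGpq.trans hGq1
  set Sh : Finset (Finset γ) := (Fq \ Fp) ∩ (Gq \ Gp) with hSh
  set Sig : Finset (Finset γ) := ((F₁ \ F₀) ∩ (G₁ \ G₀)) \ ((Fp \ Fq) ∩ (Gq \ Gp)) with hSig
  -- a row vector on the eight supply blocks `S_a, S_b, U_a, U_b, M_a, M_b, N_a, N_b`, given the eight visibility flags of a class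
  let row : Bool → Bool → Bool → Bool → Bool → Bool → Bool → Bool → Finset γ →
      (↥(P ∩ F₁ ∩ G₁) ⊕ (↥(P ∩ F₁ ∩ G₁) ⊕ (↥(P ∩ F₀ ∩ G₀) ⊕ (↥(P ∩ F₀ ∩ G₀) ⊕ (↥(P ∩ Fp ∩ Gp) ⊕ (↥(P ∩ Fp ∩ Gp) ⊕
        (↥(P ∩ Fq ∩ Gq) ⊕ ↥(P ∩ Fq ∩ Gq)))))))) → ℚ :=
    fun v0 v1 v2 v3 v4 v5 v6 v7 s =>
      Sum.elim (fun t => if v0 then zent s (t : Finset γ) else 0)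
        (Sum.elim (fun t => if v1 then zent s (t : Finset γ) else 0)
          (Sum.elim (fun t => if v2 then zent s (t : Finset γ) else 0)
            (Sum.elim (fun t => if v3 then zent s (t : Finset γ) else 0)
              (Sum.elim (fun t => if v4 then zent s (t : Finset γ) else 0)
                (Sum.elim (fun t => if v5 then zent s (t : Finset γ) else 0)
                  (Sum.elim (fun t => if v6 then zent s (t : Finset γ) else 0)
                    (fun t => if v7 then zent s (t : Finset γ) else 0)))))))
  -- design HC-0: a ↦ {S_a}, b ↦ {S_b,N_a}, c ↦ {S_b,U_b,M_a,N_b}, d ↦ {S_a,U_a}, e ↦ {S_b,M_b}, f ↦ {S_a,S_b,N_b}, g ↦ {S_a,M_a,N_a}, h ↦ {S_a,S_b},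
  -- i ↦ {N_b}, j ↦ {S_a}
  have hli : LinearIndependent ℚ
      (Sum.elim (fun s : ↥(P ∩ refl F₀ ∩ G₁) => row true false false false false false false false s)
        (Sum.elim (fun s : ↥(P ∩ F₀ ∩ refl G₁) => row false true false false false false true false s)
          (Sum.elim (fun s : ↥(P ∩ refl F₁ ∩ G₀) => row false true false true true false false true s)
            (Sum.elim (fun s : ↥(P ∩ F₁ ∩ refl G₀) => row true false true false false false false false s)
              (Sum.elim (fun s : ↥(P ∩ refl Fp ∩ Gq) => row false true false false false true false false s)
                (Sum.elim (fun s : ↥(P ∩ Fp ∩ refl Gq) => row true true false false false false false true s)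
                  (Sum.elim (fun s : ↥(P ∩ refl Fq ∩ Gp) => row true false false false true false true false s)
                    (Sum.elim (fun s : ↥(P ∩ Fq ∩ refl Gp) => row true true false false false false false false s)
                      (Sum.elim (fun s : ↥(P ∩ refl Sh) => row false false false false false false false true s)
                        (fun s : ↥(P ∩ refl Sig) => row true false false false false false false false s)))))))))) := by
    rw [Fintype.linearIndependent_iff]
    intro g hg
    -- the ten coefficient vectors on the cube
    obtain ⟨ka, hka⟩ : ∃ f : Finset γ → ℚ, ∀ s, f s = if h : s ∈ P ∩ refl F₀ ∩ G₁ then g (Sum.inl ⟨s, h⟩) else 0 := ⟨_, fun _ => rfl⟩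
    obtain ⟨kb, hkb⟩ : ∃ f : Finset γ → ℚ, ∀ s, f s = if h : s ∈ P ∩ F₀ ∩ refl G₁ then g (Sum.inr (Sum.inl ⟨s, h⟩)) else 0 :=
      ⟨_, fun _ => rfl⟩
    obtain ⟨kc, hkc⟩ : ∃ f : Finset γ → ℚ, ∀ s,
        f s = if h : s ∈ P ∩ refl F₁ ∩ G₀ then g (Sum.inr (Sum.inr (Sum.inl ⟨s, h⟩))) else 0 := ⟨_, fun _ => rfl⟩
    obtain ⟨kd, hkd⟩ : ∃ f : Finset γ → ℚ, ∀ s,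
        f s = if h : s ∈ P ∩ F₁ ∩ refl G₀ then g (Sum.inr (Sum.inr (Sum.inr (Sum.inl ⟨s, h⟩)))) else 0 := ⟨_, fun _ => rfl⟩
    obtain ⟨ke, hke⟩ : ∃ f : Finset γ → ℚ, ∀ s,
        f s = if h : s ∈ P ∩ refl Fp ∩ Gq then g (Sum.inr (Sum.inr (Sum.inr (Sum.inr (Sum.inl ⟨s, h⟩))))) else 0 := ⟨_, fun _ => rfl⟩
    obtain ⟨kf, hkf⟩ : ∃ f : Finset γ → ℚ, ∀ s,
        f s = if h : s ∈ P ∩ Fp ∩ refl Gq then g (Sum.inr (Sum.inr (Sum.inr (Sum.inr (Sum.inr (Sum.inl ⟨s, h⟩)))))) else 0 :=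
      ⟨_, fun _ => rfl⟩
    obtain ⟨kg, hkg⟩ : ∃ f : Finset γ → ℚ, ∀ s,
        f s = if h : s ∈ P ∩ refl Fq ∩ Gp then g (Sum.inr (Sum.inr (Sum.inr (Sum.inr (Sum.inr (Sum.inr (Sum.inl ⟨s, h⟩))))))) else 0 :=
      ⟨_, fun _ => rfl⟩
    obtain ⟨kh, hkh⟩ : ∃ f : Finset γ → ℚ, ∀ s,
        f s = if h : s ∈ P ∩ Fq ∩ refl Gp then
          g (Sum.inr (Sum.inr (Sum.inr (Sum.inr (Sum.inr (Sum.inr (Sum.inr (Sum.inl ⟨s, h⟩)))))))) else 0 := ⟨_, fun _ => rfl⟩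
    obtain ⟨ki, hki⟩ : ∃ f : Finset γ → ℚ, ∀ s,
        f s = if h : s ∈ P ∩ refl Sh then
          g (Sum.inr (Sum.inr (Sum.inr (Sum.inr (Sum.inr (Sum.inr (Sum.inr (Sum.inr (Sum.inl ⟨s, h⟩))))))))) else 0 := ⟨_, fun _ => rfl⟩
    obtain ⟨kj, hkj⟩ : ∃ f : Finset γ → ℚ, ∀ s,
        f s = if h : s ∈ P ∩ refl Sig then
          g (Sum.inr (Sum.inr (Sum.inr (Sum.inr (Sum.inr (Sum.inr (Sum.inr (Sum.inr (Sum.inr ⟨s, h⟩))))))))) else 0 := ⟨_, fun _ => rfl⟩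
    have hkasupp : ∀ s, ka s ≠ 0 → s ∈ P ∩ refl F₀ ∩ G₁ := by
      intro s hs; by_contra h; rw [hka s, dif_neg h] at hs; exact hs rfl
    have hkbsupp : ∀ s, kb s ≠ 0 → s ∈ P ∩ F₀ ∩ refl G₁ := by
      intro s hs; by_contra h; rw [hkb s, dif_neg h] at hs; exact hs rfl
    have hkcsupp : ∀ s, kc s ≠ 0 → s ∈ P ∩ refl F₁ ∩ G₀ := by
      intro s hs; by_contra h; rw [hkc s, dif_neg h] at hs; exact hs rfl
    have hkdsupp : ∀ s, kd s ≠ 0 → s ∈ P ∩ F₁ ∩ refl G₀ := by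
      intro s hs; by_contra h; rw [hkd s, dif_neg h] at hs; exact hs rfl
    have hkesupp : ∀ s, ke s ≠ 0 → s ∈ P ∩ refl Fp ∩ Gq := by
      intro s hs; by_contra h; rw [hke s, dif_neg h] at hs; exact hs rfl
    have hkfsupp : ∀ s, kf s ≠ 0 → s ∈ P ∩ Fp ∩ refl Gq := by
      intro s hs; by_contra h; rw [hkf s, dif_neg h] at hs; exact hs rfl
    have hkgsupp : ∀ s, kg s ≠ 0 → s ∈ P ∩ refl Fq ∩ Gp := by
      intro s hs; by_contra h; rw [hkg s, dif_neg h] at hs; exact hs rfl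
    have hkhsupp : ∀ s, kh s ≠ 0 → s ∈ P ∩ Fq ∩ refl Gp := by
      intro s hs; by_contra h; rw [hkh s, dif_neg h] at hs; exact hs rfl
    have hkisupp : ∀ s, ki s ≠ 0 → s ∈ P ∩ refl Sh := by
      intro s hs; by_contra h; rw [hki s, dif_neg h] at hs; exact hs rfl
    have hkjsupp : ∀ s, kj s ≠ 0 → s ∈ P ∩ refl Sig := by
      intro s hs; by_contra h; rw [hkj s, dif_neg h] at hs; exact hs rfl
    -- sums over the index finsets are sums over the cube
    have suma := sum_coe_zeta_eq_sum_ext (P ∩ refl F₀ ∩ G₁) (fun s => g (Sum.inl s)) ka hka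
    have sumb := sum_coe_zeta_eq_sum_ext (P ∩ F₀ ∩ refl G₁) (fun s => g (Sum.inr (Sum.inl s))) kb hkb
    have sumc := sum_coe_zeta_eq_sum_ext (P ∩ refl F₁ ∩ G₀) (fun s => g (Sum.inr (Sum.inr (Sum.inl s)))) kc hkc
    have sumd := sum_coe_zeta_eq_sum_ext (P ∩ F₁ ∩ refl G₀) (fun s => g (Sum.inr (Sum.inr (Sum.inr (Sum.inl s))))) kd hkd
    have sume := sum_coe_zeta_eq_sum_ext (P ∩ refl Fp ∩ Gq) (fun s => g (Sum.inr (Sum.inr (Sum.inr (Sum.inr (Sum.inl s)))))) ke hke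
    have sumf := sum_coe_zeta_eq_sum_ext (P ∩ Fp ∩ refl Gq)
      (fun s => g (Sum.inr (Sum.inr (Sum.inr (Sum.inr (Sum.inr (Sum.inl s))))))) kf hkf
    have sumg := sum_coe_zeta_eq_sum_ext (P ∩ refl Fq ∩ Gp)
      (fun s => g (Sum.inr (Sum.inr (Sum.inr (Sum.inr (Sum.inr (Sum.inr (Sum.inl s)))))))) kg hkg
    have sumh := sum_coe_zeta_eq_sum_ext (P ∩ Fq ∩ refl Gp)
      (fun s => g (Sum.inr (Sum.inr (Sum.inr (Sum.inr (Sum.inr (Sum.inr (Sum.inr (Sum.inl s))))))))) kh hkh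
    have sumi := sum_coe_zeta_eq_sum_ext (P ∩ refl Sh)
      (fun s => g (Sum.inr (Sum.inr (Sum.inr (Sum.inr (Sum.inr (Sum.inr (Sum.inr (Sum.inr (Sum.inl s)))))))))) ki hki
    have sumj := sum_coe_zeta_eq_sum_ext (P ∩ refl Sig)
      (fun s => g (Sum.inr (Sum.inr (Sum.inr (Sum.inr (Sum.inr (Sum.inr (Sum.inr (Sum.inr (Sum.inr s)))))))))) kj hkj
    -- the eight equations, read off the components of `hg`
    have E0 : ∀ t, t ∈ P → t ∈ F₁ → t ∈ G₁ → zsum ka t + zsum kd t + zsum kf t + zsum kg t + zsum kh t + zsum kj t = 0 := by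
      intro t htP htF htG
      have h := congrFun hg (Sum.inl ⟨t, mem_inter.2 ⟨mem_inter.2 ⟨htP, htF⟩, htG⟩⟩)
      rw [Finset.sum_apply, Fintype.sum_sum_type, Fintype.sum_sum_type, Fintype.sum_sum_type, Fintype.sum_sum_type,
        Fintype.sum_sum_type, Fintype.sum_sum_type, Fintype.sum_sum_type, Fintype.sum_sum_type, Fintype.sum_sum_type] at h
      simp only [row, zent, Pi.smul_apply, smul_eq_mul, Pi.zero_apply, Sum.elim_inl, Sum.elim_inr, mul_zero,
        Finset.sum_const_zero, if_true, if_false, Bool.false_eq_true] at h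
      rw [suma t, sumd t, sumf t, sumg t, sumh t, sumj t] at h
      unfold zsum
      linarith [h]
    have E1 : ∀ t, t ∈ P → t ∈ F₁ → t ∈ G₁ → zsum kb t + zsum kc t + zsum ke t + zsum kf t + zsum kh t = 0 := by
      intro t htP htF htG
      have h := congrFun hg (Sum.inr (Sum.inl ⟨t, mem_inter.2 ⟨mem_inter.2 ⟨htP, htF⟩, htG⟩⟩))
      rw [Finset.sum_apply, Fintype.sum_sum_type, Fintype.sum_sum_type, Fintype.sum_sum_type, Fintype.sum_sum_type,
        Fintype.sum_sum_type, Fintype.sum_sum_type, Fintype.sum_sum_type, Fintype.sum_sum_type, Fintype.sum_sum_type] at h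
      simp only [row, zent, Pi.smul_apply, smul_eq_mul, Pi.zero_apply, Sum.elim_inl, Sum.elim_inr, mul_zero,
        Finset.sum_const_zero, if_true, if_false, Bool.false_eq_true] at h
      rw [sumb t, sumc t, sume t, sumf t, sumh t] at h
      unfold zsum
      linarith [h]
    have E2 : ∀ t, t ∈ P → t ∈ F₀ → t ∈ G₀ → zsum kd t = 0 := by
      intro t htP htF htG
      have h := congrFun hg (Sum.inr (Sum.inr (Sum.inl ⟨t, mem_inter.2 ⟨mem_inter.2 ⟨htP, htF⟩, htG⟩⟩)))
      rw [Finset.sum_apply, Fintype.sum_sum_type, Fintype.sum_sum_type, Fintype.sum_sum_type, Fintype.sum_sum_type,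
        Fintype.sum_sum_type, Fintype.sum_sum_type, Fintype.sum_sum_type, Fintype.sum_sum_type, Fintype.sum_sum_type] at h
      simp only [row, zent, Pi.smul_apply, smul_eq_mul, Pi.zero_apply, Sum.elim_inl, Sum.elim_inr, mul_zero,
        Finset.sum_const_zero, if_true, if_false, Bool.false_eq_true] at h
      rw [sumd t] at h
      unfold zsum
      linarith [h]
    have E3 : ∀ t, t ∈ P → t ∈ F₀ → t ∈ G₀ → zsum kc t = 0 := by
      intro t htP htF htG
      have h := congrFun hg (Sum.inr (Sum.inr (Sum.inr (Sum.inl ⟨t, mem_inter.2 ⟨mem_inter.2 ⟨htP, htF⟩, htG⟩⟩))))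
      rw [Finset.sum_apply, Fintype.sum_sum_type, Fintype.sum_sum_type, Fintype.sum_sum_type, Fintype.sum_sum_type,
        Fintype.sum_sum_type, Fintype.sum_sum_type, Fintype.sum_sum_type, Fintype.sum_sum_type, Fintype.sum_sum_type] at h
      simp only [row, zent, Pi.smul_apply, smul_eq_mul, Pi.zero_apply, Sum.elim_inl, Sum.elim_inr, mul_zero,
        Finset.sum_const_zero, if_true, if_false, Bool.false_eq_true] at h
      rw [sumc t] at h
      unfold zsum
      linarith [h]
    have E4 : ∀ t, t ∈ P → t ∈ Fp → t ∈ Gp → zsum kc t + zsum kg t = 0 := by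
      intro t htP htF htG
      have h := congrFun hg (Sum.inr (Sum.inr (Sum.inr (Sum.inr (Sum.inl ⟨t, mem_inter.2 ⟨mem_inter.2 ⟨htP, htF⟩, htG⟩⟩)))))
      rw [Finset.sum_apply, Fintype.sum_sum_type, Fintype.sum_sum_type, Fintype.sum_sum_type, Fintype.sum_sum_type,
        Fintype.sum_sum_type, Fintype.sum_sum_type, Fintype.sum_sum_type, Fintype.sum_sum_type, Fintype.sum_sum_type] at h
      simp only [row, zent, Pi.smul_apply, smul_eq_mul, Pi.zero_apply, Sum.elim_inl, Sum.elim_inr, mul_zero,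
        Finset.sum_const_zero, if_true, if_false, Bool.false_eq_true] at h
      rw [sumc t, sumg t] at h
      unfold zsum
      linarith [h]
    have E5 : ∀ t, t ∈ P → t ∈ Fp → t ∈ Gp → zsum ke t = 0 := by
      intro t htP htF htG
      have h := congrFun hg (Sum.inr (Sum.inr (Sum.inr (Sum.inr (Sum.inr (Sum.inl ⟨t, mem_inter.2 ⟨mem_inter.2 ⟨htP, htF⟩, htG⟩⟩))))))
      rw [Finset.sum_apply, Fintype.sum_sum_type, Fintype.sum_sum_type, Fintype.sum_sum_type, Fintype.sum_sum_type,
        Fintype.sum_sum_type, Fintype.sum_sum_type, Fintype.sum_sum_type, Fintype.sum_sum_type, Fintype.sum_sum_type] at h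
      simp only [row, zent, Pi.smul_apply, smul_eq_mul, Pi.zero_apply, Sum.elim_inl, Sum.elim_inr, mul_zero,
        Finset.sum_const_zero, if_true, if_false, Bool.false_eq_true] at h
      rw [sume t] at h
      unfold zsum
      linarith [h]
    have E6 : ∀ t, t ∈ P → t ∈ Fq → t ∈ Gq → zsum kb t + zsum kg t = 0 := by
      intro t htP htF htG
      have h := congrFun hg
        (Sum.inr (Sum.inr (Sum.inr (Sum.inr (Sum.inr (Sum.inr (Sum.inl ⟨t, mem_inter.2 ⟨mem_inter.2 ⟨htP, htF⟩, htG⟩⟩)))))))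
      rw [Finset.sum_apply, Fintype.sum_sum_type, Fintype.sum_sum_type, Fintype.sum_sum_type, Fintype.sum_sum_type,
        Fintype.sum_sum_type, Fintype.sum_sum_type, Fintype.sum_sum_type, Fintype.sum_sum_type, Fintype.sum_sum_type] at h
      simp only [row, zent, Pi.smul_apply, smul_eq_mul, Pi.zero_apply, Sum.elim_inl, Sum.elim_inr, mul_zero,
        Finset.sum_const_zero, if_true, if_false, Bool.false_eq_true] at h
      rw [sumb t, sumg t] at h
      unfold zsum
      linarith [h]
    have E7 : ∀ t, t ∈ P → t ∈ Fq → t ∈ Gq → zsum kc t + zsum kf t + zsum ki t = 0 := by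
      intro t htP htF htG
      have h := congrFun hg
        (Sum.inr (Sum.inr (Sum.inr (Sum.inr (Sum.inr (Sum.inr (Sum.inr ⟨t, mem_inter.2 ⟨mem_inter.2 ⟨htP, htF⟩, htG⟩⟩)))))))
      rw [Finset.sum_apply, Fintype.sum_sum_type, Fintype.sum_sum_type, Fintype.sum_sum_type, Fintype.sum_sum_type,
        Fintype.sum_sum_type, Fintype.sum_sum_type, Fintype.sum_sum_type, Fintype.sum_sum_type, Fintype.sum_sum_type] at h
      simp only [row, zent, Pi.smul_apply, smul_eq_mul, Pi.zero_apply, Sum.elim_inl, Sum.elim_inr, mul_zero,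
        Finset.sum_const_zero, if_true, if_false, Bool.false_eq_true] at h
      rw [sumc t, sumf t, sumi t] at h
      unfold zsum
      linarith [h]
    -- the kernel lemma
    have K := halfChain_kernel_eq_zero_of_upperSet P F₀ Fp Fq F₁ G₀ Gp Gq G₁ hP hF₀ hFp hFq hF₁ hG₀ hGp hGq hG₁
      hF0p hF0q hFp1 hFq1 hG0p hGpq hGq1 ka kb kc kd ke kf kg kh ki kj ?_ ?_ ?_ ?_ ?_ ?_ ?_ ?_ ?_ ?_ E0 E1 E2 E3 E4 E5 E6 E7
    · rintro (⟨s, hs⟩ | ⟨s, hs⟩ | ⟨s, hs⟩ | ⟨s, hs⟩ | ⟨s, hs⟩ | ⟨s, hs⟩ | ⟨s, hs⟩ | ⟨s, hs⟩ | ⟨s, hs⟩ | ⟨s, hs⟩)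
      · have h := K.1 s
        rwa [hka s, dif_pos hs] at h
      · have h := K.2.1 s
        rwa [hkb s, dif_pos hs] at h
      · have h := K.2.2.1 s
        rwa [hkc s, dif_pos hs] at h
      · have h := K.2.2.2.1 s
        rwa [hkd s, dif_pos hs] at h
      · have h := K.2.2.2.2.1 s
        rwa [hke s, dif_pos hs] at h
      · have h := K.2.2.2.2.2.1 s
        rwa [hkf s, dif_pos hs] at h
      · have h := K.2.2.2.2.2.2.1 s
        rwa [hkg s, dif_pos hs] at h
      · have h := K.2.2.2.2.2.2.2.1 s
        rwa [hkh s, dif_pos hs] at h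
      · have h := K.2.2.2.2.2.2.2.2.1 s
        rwa [hki s, dif_pos hs] at h
      · have h := K.2.2.2.2.2.2.2.2.2 s
        rwa [hkj s, dif_pos hs] at h
    · intro s hs
      have h := hkasupp s hs
      exact ⟨(mem_inter.1 (mem_inter.1 h).1).1, mem_refl.1 (mem_inter.1 (mem_inter.1 h).1).2, (mem_inter.1 h).2⟩
    · intro s hs
      have h := hkbsupp s hs
      exact ⟨(mem_inter.1 (mem_inter.1 h).1).1, (mem_inter.1 (mem_inter.1 h).1).2, mem_refl.1 (mem_inter.1 h).2⟩
    · intro s hs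
      have h := hkcsupp s hs
      exact ⟨(mem_inter.1 (mem_inter.1 h).1).1, mem_refl.1 (mem_inter.1 (mem_inter.1 h).1).2, (mem_inter.1 h).2⟩
    · intro s hs
      have h := hkdsupp s hs
      exact ⟨(mem_inter.1 (mem_inter.1 h).1).1, (mem_inter.1 (mem_inter.1 h).1).2, mem_refl.1 (mem_inter.1 h).2⟩
    · intro s hs
      have h := hkesupp s hs
      exact ⟨(mem_inter.1 (mem_inter.1 h).1).1, mem_refl.1 (mem_inter.1 (mem_inter.1 h).1).2, (mem_inter.1 h).2⟩
    · intro s hs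
      have h := hkfsupp s hs
      exact ⟨(mem_inter.1 (mem_inter.1 h).1).1, (mem_inter.1 (mem_inter.1 h).1).2, mem_refl.1 (mem_inter.1 h).2⟩
    · intro s hs
      have h := hkgsupp s hs
      exact ⟨(mem_inter.1 (mem_inter.1 h).1).1, mem_refl.1 (mem_inter.1 (mem_inter.1 h).1).2, (mem_inter.1 h).2⟩
    · intro s hs
      have h := hkhsupp s hs
      exact ⟨(mem_inter.1 (mem_inter.1 h).1).1, (mem_inter.1 (mem_inter.1 h).1).2, mem_refl.1 (mem_inter.1 h).2⟩
    · intro s hs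
      have h := hkisupp s hs
      exact ⟨(mem_inter.1 h).1, mem_refl.1 (mem_inter.1 h).2⟩
    · intro s hs
      have h := hkjsupp s hs
      exact ⟨(mem_inter.1 h).1, mem_refl.1 (mem_inter.1 h).2⟩
  -- count: independent vectors are at most the dimension
  have hcard := hli.fintype_card_le_finrank
  rw [Module.finrank_fintype_fun_eq_card] at hcard
  simp only [Fintype.card_sum, Fintype.card_coe] at hcard
  rw [hSh, hSig] at hcard
  rw [halfChain_pair_eq_counts P F₀ Fp Fq F₁ G₀ Gp Gq G₁ hF0p hF0q hFp1 hFq1 hG0p hG0q hGp1 hGq1 hGpq]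
  push_cast
  omega

/-- **(HC) HOLDS** (`HalfChainMidIneq` of `…TriWHalfChainMid`). [this work] -/
theorem halfChainMidIneq_holds : HalfChainMidIneq := by
  intro γ _ _ P F₀ A A' F₁ G₀ B B' G₁ hP hF₀ hA hA' hF₁ hG₀ hB hB' hG₁ h₁ h₂ h₃ h₄ hG₀B hBB' hB'G₁
  have h := halfChain_pair_nonneg P F₀ A A' F₁ G₀ B B' G₁ hP hF₀ hA hA' hF₁ hG₀ hB hB' hG₁ h₁ h₂ h₃ h₄ hG₀B hBB' hB'G₁
  rw [triWOne_split_left P F₀ F₁ G₀ G₁, triWOne_split_left P A A' B B'] at h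
  linarith

variable {β : Type} [DecidableEq β] [Fintype β]

/-- **THE HALF-CHAIN STRATUM OF `TRI_W(2)` (unconditional).**  `univ = {a, b}`, `G {a} ⊆ G {b}`, `F` arbitrary ⟹ `0 ≤ triW P F G`. [this work] -/
theorem triW_nonneg_of_halfChain {a b : β} (hab : a ≠ b) (hu : (univ : Finset β) = {a, b}) (P : Finset (Finset γ))
    (F G : Finset β → Finset (Finset γ)) (hP : IsUpperSet (P : Set (Finset γ))) (hF : ∀ x, IsUpperSet (F x : Set (Finset γ)))
    (hG : ∀ x, IsUpperSet (G x : Set (Finset γ))) (hFm : Monotone F) (hGm : Monotone G) (hGab : G {a} ⊆ G {b}) :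
    0 ≤ triW P F G :=
  triW_nonneg_two_of_halfChainMid halfChainMidIneq_holds hab hu P F G hP hF hG hFm hGm hGab

/-- **`TRI_W(2) ≥ 0` WHENEVER AT LEAST ONE FAMILY HAS COMPARABLE MIDDLE FIBRES** (`F {a} ⊆ F {b} ∨ F {b} ⊆ F {a} ∨ G {a} ⊆ G {b} ∨ G {b} ⊆ G {a}`). [this work] -/
theorem triW_nonneg_two_of_one_comparable {a b : β} (hab : a ≠ b) (hu : (univ : Finset β) = {a, b}) (P : Finset (Finset γ))
    (F G : Finset β → Finset (Finset γ)) (hP : IsUpperSet (P : Set (Finset γ))) (hF : ∀ x, IsUpperSet (F x : Set (Finset γ)))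
    (hG : ∀ x, IsUpperSet (G x : Set (Finset γ))) (hFm : Monotone F) (hGm : Monotone G)
    (h : F {a} ⊆ F {b} ∨ F {b} ⊆ F {a} ∨ G {a} ⊆ G {b} ∨ G {b} ⊆ G {a}) :
    0 ≤ triW P F G := by
  have hu' : (univ : Finset β) = {b, a} := by rw [hu, pair_comm]
  rcases h with h | h | h | h
  · rw [triW_symm]; exact triW_nonneg_of_halfChain hab hu P G F hP hG hF hGm hFm h
  · rw [triW_symm]; exact triW_nonneg_of_halfChain hab.symm hu' P G F hP hG hF hGm hFm h
  · exact triW_nonneg_of_halfChain hab hu P F G hP hF hG hFm hGm h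
  · exact triW_nonneg_of_halfChain hab.symm hu' P F G hP hF hG hFm hGm h

end FiveUpSet

end Summit.CriticalPhenomena.PercolationContinuityZ3.Theorems
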